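import Mathlib
import HarnessLib

/-!
# The aligned half of the block inequality, I: leaf certificates and per-block regime bounds (row 96c)

Honest framing: exact (Metropolis-corrected) sampling algorithms for lattice gauge theory; figures
of merit are autocorrelation/cost numbers at stated couplings and volumes; no continuum-physics
claim.  This file is elementary real algebra (polynomial inequalities in at most five reals).

Context.  `AcceptanceCurveSwap` (row 96a) reduced clause (ii) of `sum_min_curve` on the whole
acceptance range `[½, 1]` to the block inequality `|(ab - ef) - (cd - gh)| ≤ L(1 - L)`,
`L = |a + b - c - d| + |ad - bc| + |eh - fg| ≤ ½`, and `AcceptanceCurveSwapLower` (row 96b)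
proved its anti-aligned half.  This file and `AcceptanceCurveFull` (row 96d) prove the aligned
half.  Reduced variables: mass transfer `t = a + b - c - d ∈ [0, ½]`, block weights
`w₁ = (a+b+c+d)/2`, `w₂ = (e+f+g+h)/2` (`w₁ + w₂ = 1`), heavy / light block masses
`Xᵢ = wᵢ + t/2`, `Yᵢ = wᵢ - t/2 ≥ 0`, orientations `ℓ₁ = ad - bc`, `ℓ₂ = fg - eh ≥ 0` and
excesses `Φ₁ = ab - cd`, `Φ₂ = gh - ef`; the claim is `Φ₁ + Φ₂ ≤ L(1 - L)`, `L = t + ℓ₁ + ℓ₂`.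

Architecture.  Maximising each block's excess over its free corner mass at fixed `(t, wᵢ, ℓᵢ)`
gives two regimes per block: before the junction (`ℓᵢXᵢ ≤ twᵢYᵢ`) the chord bound
`2XᵢΦᵢ ≤ twᵢXᵢ + Yᵢℓᵢ` (§4, `regimeI_chord`), beyond it a C-vertex value `v(Xᵢ - v)` with
`vYᵢ ≤ ℓᵢ`, `twᵢ ≤ vXᵢ`, `v ≤ Xᵢ/2` (§4, `regimeII_vertex`).  The resulting two-block bound is
concave in `ℓ₁`, so it is checked at vertices: `vertex_zc`, `vertex_cc` (§2, explicit
sum-of-squares identities) and on the budget facet `t + ℓ₁ + vY₂ = ½`, where it is the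
**facet leaf** (§1): a polynomial inequality in `(t, w₁, v)` closed by an explicit degree-four
Positivstellensatz certificate — a nonnegative rational combination of 32 products of the
constraint atoms, found by linear programming and verified here by `linarith`.  §3 glues the
mixed edge by concave interpolation.  The master lemma and the assembly are in
`AcceptanceCurveFull`.  No `sorry`, no new axioms, no `def`.
-/

namespace Summit.Ventures.LatticeQCDFlow.TrivializingMaps.Curve

/-! ## §1. The facet leaf: an explicit degree-four Positivstellensatz certificate

Variables: coupling `t ∈ [0, ½]`, block weights `w₁ + w₂ = 1`, heavy / light block masses
`Xᵢ = wᵢ + t/2`, `Yᵢ = wᵢ - t/2 ≥ 0`, and the C-vertex parameter `v` of block 2.  On the budget facet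
the orientation of block 1 is `ℓ₁ = (½ - t) - v Y₂`. -/

set_option maxHeartbeats 800000 in
/-- **The facet leaf.**  For `t ≥ 0`, `w₁ + w₂ = 1`, `Yᵢ ≥ 0`, `0 ≤ v ≤ X₂/2`, `t w₂ ≤ v X₂`
(block 2 beyond its junction), `ℓ₁ := (½ - t) - v Y₂ ≥ 0` and `X₁ ℓ₁ ≤ t w₁ Y₁` (block 1 before its
junction): `2 X₁ (¼ - t w₁/2 - v X₂ + v²) - ℓ₁ Y₁ ≥ 0`.  Proof: a nonnegative rational combination of
32 products of degree ≤ 4 of the eleven nonnegative atoms (found by linear programming, exact). -/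
theorem facet_leaf (t w₁ w₂ v : ℝ) (hw : w₁ + w₂ = 1) (ht : 0 ≤ t) (hσ : 0 ≤ 1 / 2 - t)
    (hw₁ : 0 ≤ w₁) (hw₂ : 0 ≤ w₂) (hY₁ : 0 ≤ w₁ - t / 2) (hY₂ : 0 ≤ w₂ - t / 2) (hv : 0 ≤ v)
    (hhv : 0 ≤ (w₂ + t / 2) - 2 * v) (hII : 0 ≤ v * (w₂ + t / 2) - t * w₂)
    (hℓ : 0 ≤ (1 / 2 - t) - v * (w₂ - t / 2))
    (hI : 0 ≤ t * w₁ * (w₁ - t / 2) - (w₁ + t / 2) * ((1 / 2 - t) - v * (w₂ - t / 2))) :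
    0 ≤ 2 * (w₁ + t / 2) * (1 / 4 - t * w₁ / 2 - v * (w₂ + t / 2) + v ^ 2)
          - ((1 / 2 - t) - v * (w₂ - t / 2)) * (w₁ - t / 2) := by
  have hw2 : w₂ = 1 - w₁ := by linarith
  subst hw2
  linarith [mul_nonneg hII hI,
    mul_nonneg (mul_nonneg (mul_nonneg hY₁ hv) hII) hw₁,
    mul_nonneg (mul_nonneg (mul_nonneg ht hσ) hY₁) hv,
    mul_nonneg (mul_nonneg (mul_nonneg hσ hY₁) hY₁) hII,
    mul_nonneg (mul_nonneg ht hℓ) hw₂,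
    mul_nonneg (mul_nonneg (mul_nonneg ht ht) hhv) hw₁,
    mul_nonneg (mul_nonneg (mul_nonneg ht hY₁) hv) hII,
    mul_nonneg (mul_nonneg (mul_nonneg ht hY₁) hhv) hℓ,
    mul_nonneg (mul_nonneg hσ hY₁) hI,
    mul_nonneg (mul_nonneg ht hσ) hI,
    mul_nonneg (mul_nonneg (mul_nonneg hhv hhv) hw₁) hw₁,
    mul_nonneg (mul_nonneg (mul_nonneg hY₁ hY₁) hY₂) hw₁,
    mul_nonneg (mul_nonneg (mul_nonneg hY₁ hY₁) hY₂) hv,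
    mul_nonneg (mul_nonneg hY₁ hY₂) hI,
    mul_nonneg (mul_nonneg (mul_nonneg hY₁ hII) hw₁) hw₁,
    mul_nonneg (mul_nonneg (mul_nonneg ht ht) hhv) hhv,
    mul_nonneg (mul_nonneg (mul_nonneg hσ hY₁) hY₁) hw₁,
    mul_nonneg (mul_nonneg (mul_nonneg ht hσ) hY₁) hII,
    mul_nonneg (mul_nonneg (mul_nonneg ht hσ) hY₁) hY₁,
    mul_nonneg (mul_nonneg (mul_nonneg ht ht) ht) hℓ,
    mul_nonneg (mul_nonneg (mul_nonneg hσ hY₁) hv) hℓ,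
    mul_nonneg hY₂ hI,
    mul_nonneg (mul_nonneg ht hσ) hℓ,
    mul_nonneg (mul_nonneg hY₁ hII) hw₁,
    mul_nonneg (mul_nonneg ht hhv) hℓ,
    mul_nonneg (mul_nonneg (mul_nonneg ht hσ) hσ) hY₁,
    mul_nonneg (mul_nonneg hY₁ hhv) hhv,
    mul_nonneg (mul_nonneg (mul_nonneg ht hhv) hhv) hw₁,
    mul_nonneg (mul_nonneg (mul_nonneg ht hℓ) hw₁) hw₁,
    mul_nonneg (mul_nonneg (mul_nonneg ht ht) ht) hhv,
    mul_nonneg (mul_nonneg (mul_nonneg hY₁ hY₁) hY₁) hhv,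
    mul_nonneg (mul_nonneg hv hℓ) hw₁]

/-! ## §2. The two vertex families (explicit sum-of-squares identities) -/

/-- **Z/C vertex.**  Block 1 without orientation (its excess at most `t w₁/2`), block 2 at the
C-vertex `v` with orientation `v Y₂`, budget slack `½ - t - v Y₂ ≥ 0`:
`2X₁[(t + vY₂)(1 - t - vY₂) - v(X₂ - v)] - t w₁ X₁ = 2X₁ t β + t Y₁ Y₂ + (1 + Y₂)(2X₁v - t)²/2 ≥ 0`. -/
theorem vertex_zc (t w₁ w₂ v : ℝ) (hw : w₁ + w₂ = 1) (ht : 0 ≤ t) (hY₁ : 0 ≤ w₁ - t / 2)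
    (hY₂ : 0 ≤ w₂ - t / 2) (hβ : 0 ≤ 1 / 2 - t - v * (w₂ - t / 2)) :
    0 ≤ 2 * (w₁ + t / 2) * ((t + v * (w₂ - t / 2)) * (1 - (t + v * (w₂ - t / 2)))
          - v * ((w₂ + t / 2) - v)) - t * w₁ * (w₁ + t / 2) := by
  have hw2 : w₂ = 1 - w₁ := by linarith
  subst hw2
  have hX₁ : 0 ≤ w₁ + t / 2 := by linarith
  nlinarith [mul_nonneg (mul_nonneg hX₁ ht) hβ, mul_nonneg (mul_nonneg ht hY₁) hY₂,
    mul_nonneg (by linarith : (0:ℝ) ≤ 1 + (1 - w₁ - t / 2)) (sq_nonneg (2 * (w₁ + t / 2) * v - t))]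

set_option maxHeartbeats 800000 in
/-- **C/C vertex.**  Both blocks at C-vertices `u ≤ w₁`, `v ≤ w₂` (orientations `uY₁`, `vY₂`,
excesses `u(X₁-u)`, `v(X₂-v)`), budget slack `β ≥ 0`: with `L = t + uY₁ + vY₂`,
`L(1-L) - u(X₁-u) - v(X₂-v) = tβ + H` and
`4X₁X₂·H = 2tY₁Y₂[2X₁(w₂-v) + 2X₂(w₁-u) + (w₁-w₂)² + t] + (t + Y₂(2w₂+t))A² + (t + Y₁(2w₁+t))B²
 + Y₁Y₂(A-B)²`, `A = 2X₁v - t`, `B = 2X₂u - t`. -/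
theorem vertex_cc (t w₁ w₂ u v : ℝ) (hw : w₁ + w₂ = 1) (ht : 0 ≤ t) (hY₁ : 0 ≤ w₁ - t / 2)
    (hY₂ : 0 ≤ w₂ - t / 2) (hu : 0 ≤ u) (hv : 0 ≤ v) (huw : u ≤ w₁) (hvw : v ≤ w₂)
    (hβ : 0 ≤ 1 / 2 - (t + u * (w₁ - t / 2) + v * (w₂ - t / 2))) :
    u * ((w₁ + t / 2) - u) + v * ((w₂ + t / 2) - v)
      ≤ (t + u * (w₁ - t / 2) + v * (w₂ - t / 2)) * (1 - (t + u * (w₁ - t / 2) + v * (w₂ - t / 2))) := by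
  have hw2 : w₂ = 1 - w₁ := by linarith
  subst hw2
  have hX₁ : 0 ≤ w₁ + t / 2 := by linarith
  have hX₂ : 0 ≤ (1 - w₁) + t / 2 := by linarith
  -- `4 X₁ X₂ · (goal slack) ≥ 0` from the sum-of-squares identity
  have h4 : 0 ≤ (4 * (w₁ + t / 2) * ((1 - w₁) + t / 2)) *
      ((t + u * (w₁ - t / 2) + v * ((1 - w₁) - t / 2))
          * (1 - (t + u * (w₁ - t / 2) + v * ((1 - w₁) - t / 2)))
        - (u * ((w₁ + t / 2) - u) + v * (((1 - w₁) + t / 2) - v))) := by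
    linarith [mul_nonneg (mul_nonneg (mul_nonneg hX₁ hX₂) ht) hβ,
      mul_nonneg (mul_nonneg (mul_nonneg (mul_nonneg ht hY₁) hY₂) hX₁) (sub_nonneg.2 hvw),
      mul_nonneg (mul_nonneg (mul_nonneg (mul_nonneg ht hY₁) hY₂) hX₂) (sub_nonneg.2 huw),
      mul_nonneg (mul_nonneg (mul_nonneg ht hY₁) hY₂) (sq_nonneg (w₁ - (1 - w₁))),
      mul_nonneg (mul_nonneg (mul_nonneg ht hY₁) hY₂) ht,
      mul_nonneg ht (sq_nonneg (2 * (w₁ + t / 2) * v - t)),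
      mul_nonneg (mul_nonneg hY₂ (by linarith : (0:ℝ) ≤ 2 * (1 - w₁) + t))
        (sq_nonneg (2 * (w₁ + t / 2) * v - t)),
      mul_nonneg ht (sq_nonneg (2 * ((1 - w₁) + t / 2) * u - t)),
      mul_nonneg (mul_nonneg hY₁ (by linarith : (0:ℝ) ≤ 2 * w₁ + t))
        (sq_nonneg (2 * ((1 - w₁) + t / 2) * u - t)),
      mul_nonneg (mul_nonneg hY₁ hY₂)
        (sq_nonneg ((2 * (w₁ + t / 2) * v - t) - (2 * ((1 - w₁) + t / 2) * u - t)))]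
  rcases eq_or_lt_of_le hX₁ with hX₁0 | hX₁pos
  · -- block 1 empty: `w₁ = t = 0`, `u = 0`
    have ht0 : t = 0 := by linarith
    have hw0 : w₁ = 0 := by linarith
    have hu0 : u = 0 := by linarith
    subst ht0 hw0 hu0
    nlinarith
  rcases eq_or_lt_of_le hX₂ with hX₂0 | hX₂pos
  · have ht0 : t = 0 := by linarith
    have hw0 : w₁ = 1 := by linarith
    have hv0 : v = 0 := by linarith
    subst ht0 hw0 hv0
    nlinarith
  have hXX : 0 < 4 * (w₁ + t / 2) * ((1 - w₁) + t / 2) := by positivity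
  exact sub_nonneg.1 ((mul_nonneg_iff_of_pos_left hXX).1 h4)

/-! ## §3. The mixed edge: concave interpolation between the two vertices and the facet leaf -/

/-- Concave interpolation: `f(z) = 2X((c+z)(1-(c+z)) - K) - T - Yz` is a concave quadratic in `z`,
so `f(0) ≥ 0` and `f(m) ≥ 0` give `f ≥ 0` on `[0, m]`
(`m f(z) = (m-z) f(0) + z f(m) + 2X m z (m-z)`). -/
theorem concave_interp (X c K T Y m z : ℝ) (hX : 0 ≤ X) (hz : 0 ≤ z) (hzm : z ≤ m)
    (h0 : 0 ≤ 2 * X * (c * (1 - c) - K) - T)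
    (hm : 0 ≤ 2 * X * ((c + m) * (1 - (c + m)) - K) - T - Y * m) :
    0 ≤ 2 * X * ((c + z) * (1 - (c + z)) - K) - T - Y * z := by
  rcases eq_or_lt_of_le (hz.trans hzm) with hm0 | hmpos
  · have hz0 : z = 0 := by linarith
    subst hz0; simpa using h0
  have key : m * (2 * X * ((c + z) * (1 - (c + z)) - K) - T - Y * z)
      = (m - z) * (2 * X * (c * (1 - c) - K) - T)
        + z * (2 * X * ((c + m) * (1 - (c + m)) - K) - T - Y * m) + 2 * X * m * z * (m - z) := by
    ring
  have hprod : 0 ≤ m * (2 * X * ((c + z) * (1 - (c + z)) - K) - T - Y * z) := by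
    rw [key]
    have h1 := mul_nonneg (sub_nonneg.2 hzm) h0
    have h2 := mul_nonneg hz hm
    have h3 := mul_nonneg (mul_nonneg (mul_nonneg (mul_nonneg (by norm_num : (0:ℝ) ≤ 2) hX)
      hmpos.le) hz) (sub_nonneg.2 hzm)
    linarith
  exact (mul_nonneg_iff_of_pos_left hmpos).1 hprod

/-- **The mixed edge.**  Block 1 before its junction (`X₁ℓ₁ ≤ tw₁Y₁`, excess bounded by the chord
`(tw₁X₁ + Y₁ℓ₁)/(2X₁)`), block 2 at a C-vertex `v ≤ X₂/2` beyond its junction (`tw₂ ≤ vX₂`), budget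
`t + ℓ₁ + vY₂ ≤ ½`: `tw₁X₁ + Y₁ℓ₁ + 2X₁·v(X₂-v) ≤ 2X₁·L(1-L)`, `L = t + ℓ₁ + vY₂`.  Proof: the
slack is concave in `ℓ₁`; its value at `ℓ₁ = 0` is `vertex_zc`, at the end of the admissible
`ℓ₁`-interval it is `facet_leaf` (budget binds first) or `vertex_cc` (junction binds first). -/
theorem mixed_edge (t w₁ w₂ ℓ₁ v : ℝ) (hw : w₁ + w₂ = 1) (ht : 0 ≤ t) (hY₁ : 0 ≤ w₁ - t / 2)
    (hY₂ : 0 ≤ w₂ - t / 2) (hX₁ : 0 < w₁ + t / 2) (hℓ₁ : 0 ≤ ℓ₁)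
    (hI : ℓ₁ * (w₁ + t / 2) ≤ t * w₁ * (w₁ - t / 2)) (hv : 0 ≤ v) (hhv : 2 * v ≤ w₂ + t / 2)
    (hII : t * w₂ ≤ v * (w₂ + t / 2)) (hL : t + ℓ₁ + v * (w₂ - t / 2) ≤ 1 / 2) :
    t * w₁ * (w₁ + t / 2) + (w₁ - t / 2) * ℓ₁ + 2 * (w₁ + t / 2) * (v * ((w₂ + t / 2) - v))
      ≤ 2 * (w₁ + t / 2) * ((t + ℓ₁ + v * (w₂ - t / 2)) * (1 - (t + ℓ₁ + v * (w₂ - t / 2)))) := by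
  have hw₁ : 0 ≤ w₁ := by linarith
  have hw₂ : 0 ≤ w₂ := by linarith
  have hvY : 0 ≤ v * (w₂ - t / 2) := mul_nonneg hv hY₂
  -- value at `ℓ₁ = 0`
  have h0 := vertex_zc t w₁ w₂ v hw ht hY₁ hY₂ (by linarith)
  -- common shape for `concave_interp`: X = X₁, c = t + vY₂, K = v(X₂-v), T = tw₁X₁, Y = Y₁
  have h0' : 0 ≤ 2 * (w₁ + t / 2) * ((t + v * (w₂ - t / 2)) * (1 - (t + v * (w₂ - t / 2)))
      - v * ((w₂ + t / 2) - v)) - t * w₁ * (w₁ + t / 2) := h0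
  suffices hmain : 0 ≤ 2 * (w₁ + t / 2) * (((t + v * (w₂ - t / 2)) + ℓ₁)
      * (1 - ((t + v * (w₂ - t / 2)) + ℓ₁)) - v * ((w₂ + t / 2) - v))
      - t * w₁ * (w₁ + t / 2) - (w₁ - t / 2) * ℓ₁ by
    linarith [hmain]
  by_cases hF : (w₁ + t / 2) * ((1 / 2 - t) - v * (w₂ - t / 2)) ≤ t * w₁ * (w₁ - t / 2)
  · -- the budget facet is reached first: endpoint `m = (½ - t) - vY₂`, value = `facet_leaf`
    have hm : ℓ₁ ≤ (1 / 2 - t) - v * (w₂ - t / 2) := by linarith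
    have hleaf := facet_leaf t w₁ w₂ v hw ht (by linarith) hw₁ hw₂ hY₁ hY₂ hv (by linarith)
      (by linarith) (by linarith) (by linarith)
    refine concave_interp (w₁ + t / 2) (t + v * (w₂ - t / 2)) (v * ((w₂ + t / 2) - v))
      (t * w₁ * (w₁ + t / 2)) (w₁ - t / 2) ((1 / 2 - t) - v * (w₂ - t / 2)) ℓ₁ hX₁.le hℓ₁ hm
      h0' ?_
    linarith [hleaf]
  · -- the junction of block 1 is reached first: endpoint `m = u₀ Y₁`, `u₀ X₁ = t w₁`, value = `vertex_cc`
    have hF' : t * w₁ * (w₁ - t / 2) < (w₁ + t / 2) * ((1 / 2 - t) - v * (w₂ - t / 2)) :=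
      lt_of_not_ge hF
    set u₀ : ℝ := t * w₁ / (w₁ + t / 2) with hu₀def
    have hu₀X : u₀ * (w₁ + t / 2) = t * w₁ := by
      rw [hu₀def]; exact div_mul_cancel₀ (t * w₁) hX₁.ne'
    have hu₀0 : 0 ≤ u₀ := by rw [hu₀def]; positivity
    have hu₀w : u₀ ≤ w₁ := by
      rw [hu₀def, div_le_iff₀ hX₁]; nlinarith [mul_nonneg hw₁ hY₁]
    have hm : ℓ₁ ≤ u₀ * (w₁ - t / 2) := by
      -- `ℓ₁ X₁ ≤ t w₁ Y₁ = u₀ X₁ Y₁`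
      have h1 : ℓ₁ * (w₁ + t / 2) ≤ (u₀ * (w₁ - t / 2)) * (w₁ + t / 2) := by
        calc ℓ₁ * (w₁ + t / 2) ≤ t * w₁ * (w₁ - t / 2) := hI
          _ = (u₀ * (w₁ - t / 2)) * (w₁ + t / 2) := by rw [← hu₀X]; ring
      exact le_of_mul_le_mul_right h1 hX₁
    have hβ : 0 ≤ 1 / 2 - (t + u₀ * (w₁ - t / 2) + v * (w₂ - t / 2)) := by
      -- from `t w₁ Y₁ < X₁ ((½ - t) - v Y₂)` and `u₀ X₁ = t w₁`
      have h1 : (u₀ * (w₁ - t / 2)) * (w₁ + t / 2) < ((1 / 2 - t) - v * (w₂ - t / 2)) * (w₁ + t / 2) := by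
        calc (u₀ * (w₁ - t / 2)) * (w₁ + t / 2) = t * w₁ * (w₁ - t / 2) := by rw [← hu₀X]; ring
          _ < _ := by linarith [hF']
      have := lt_of_mul_lt_mul_right h1 hX₁.le
      linarith
    have hcc := vertex_cc t w₁ w₂ u₀ v hw ht hY₁ hY₂ hu₀0 hv hu₀w (by linarith) hβ
    -- junction identity: N(u₀Y₁) = 2X₁·(cc slack) + (t w₁ - u₀ X₁)(2u₀ - X₁), second term = 0
    have hz : (t * w₁ - u₀ * (w₁ + t / 2)) * (2 * u₀ - (w₁ + t / 2)) = 0 := by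
      rw [← hu₀X]; ring
    refine concave_interp (w₁ + t / 2) (t + v * (w₂ - t / 2)) (v * ((w₂ + t / 2) - v))
      (t * w₁ * (w₁ + t / 2)) (w₁ - t / 2) (u₀ * (w₁ - t / 2)) ℓ₁ hX₁.le hℓ₁ hm h0' ?_
    have hw2 : w₂ = 1 - w₁ := by linarith
    subst hw2
    linarith [mul_nonneg hX₁.le (sub_nonneg.2 hcc), hz]

/-! ## §4. Per-block regime bounds for an abstract block excess `P`

A block with weight `w`, masses `X = w + t/2 ≥ Y = w - t/2 ≥ 0` and orientation `0 ≤ ℓ ≤ XY` has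
excess `P` obeying the unconstrained-supremum bound `2twP ≤ (tw)² + ℓ²`, the cap `P ≤ tw/2 + ℓ`,
and, beyond the junction (`twY ≤ ℓX`), `Y²P ≤ ℓ(XY - ℓ)` (§6 proves these for the actual corner
masses).  From them: the chord bound before the junction, and a C-vertex `v ≤ X/2` beyond it. -/

/-- Regime I (`ℓX ≤ twY`): the chord bound `2XP ≤ twX + Yℓ`. -/
theorem regimeI_chord (t w ℓ P : ℝ) (ht : 0 ≤ t) (hY : 0 ≤ w - t / 2) (hℓ : 0 ≤ ℓ)
    (hℓc : ℓ ≤ (w + t / 2) * (w - t / 2)) (hsup : 2 * t * w * P ≤ (t * w) ^ 2 + ℓ ^ 2)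
    (hcap : P ≤ t * w / 2 + ℓ) (hr : ℓ * (w + t / 2) ≤ t * w * (w - t / 2)) :
    2 * (w + t / 2) * P ≤ t * w * (w + t / 2) + (w - t / 2) * ℓ := by
  have hw : 0 ≤ w := by linarith
  have hX : 0 ≤ w + t / 2 := by linarith
  rcases eq_or_lt_of_le hX with hX0 | hXpos
  · -- empty block: `t = w = 0`
    have ht0 : t = 0 := by linarith
    have hw0 : w = 0 := by linarith
    subst ht0 hw0
    linarith
  rcases eq_or_lt_of_le (mul_nonneg ht hw) with htw | htw
  · -- `t w = 0`: then `ℓ = 0` (from `hr`) and `P ≤ 0` (from `hcap`)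
    have hr' : ℓ * (w + t / 2) ≤ 0 := by rw [← htw] at hr; linarith
    have hℓ0 : ℓ ≤ 0 := by
      by_contra hne
      have : 0 < ℓ * (w + t / 2) := mul_pos (lt_of_not_ge hne) hXpos
      linarith
    have hP : P ≤ 0 := by rw [← htw] at hcap; linarith
    rw [← htw]
    nlinarith [mul_nonneg hX (neg_nonneg.2 hP), mul_nonneg hY hℓ]
  · -- `t w > 0`: `tw·(slack) = X·((tw)² + ℓ² - 2twP) + ℓ(twY - ℓX) ≥ 0`
    have key : t * w * (t * w * (w + t / 2) + (w - t / 2) * ℓ - 2 * (w + t / 2) * P)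
        = (w + t / 2) * ((t * w) ^ 2 + ℓ ^ 2 - 2 * t * w * P)
          + ℓ * (t * w * (w - t / 2) - ℓ * (w + t / 2)) := by
      ring
    have h1 : 0 ≤ t * w * (t * w * (w + t / 2) + (w - t / 2) * ℓ - 2 * (w + t / 2) * P) := by
      rw [key]
      exact add_nonneg (mul_nonneg hX (by linarith)) (mul_nonneg hℓ (by linarith))
    have := (mul_nonneg_iff_of_pos_left htw).1 h1
    linarith

/-- From the chord bound: `P ≤ (tw + ℓ)/2` (used in the case where both blocks are before their
junctions, giving `F ≤ L/2 ≤ L(1-L)`). -/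
theorem chord_half (t w ℓ P : ℝ) (ht : 0 ≤ t) (hY : 0 ≤ w - t / 2) (hℓ : 0 ≤ ℓ)
    (hℓc : ℓ ≤ (w + t / 2) * (w - t / 2)) (hcap : P ≤ t * w / 2 + ℓ)
    (b : 2 * (w + t / 2) * P ≤ t * w * (w + t / 2) + (w - t / 2) * ℓ) :
    P ≤ (t * w + ℓ) / 2 := by
  have hX : 0 ≤ w + t / 2 := by linarith
  rcases eq_or_lt_of_le hX with hX0 | hXpos
  · have ht0 : t = 0 := by linarith
    have hw0 : w = 0 := by linarith
    subst ht0 hw0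
    norm_num at hℓc hcap ⊢
    linarith
  · have hYX : (w - t / 2) * ℓ ≤ (w + t / 2) * ℓ := mul_le_mul_of_nonneg_right (by linarith) hℓ
    have h1 : (w + t / 2) * (2 * P) ≤ (w + t / 2) * (t * w + ℓ) := by nlinarith [b, hYX]
    have := le_of_mul_le_mul_left h1 hXpos
    linarith

/-- Regime II (`twY < ℓX`): a C-vertex parameter `v` with `0 ≤ v ≤ X/2`, `tw ≤ vX`, `vY ≤ ℓ` and
`P ≤ v(X - v)` (namely `v₀ = ℓ/Y`, replaced by `X/2` if `v₀ > X/2`). -/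
theorem regimeII_vertex (t w ℓ P : ℝ) (ht : 0 ≤ t) (hY : 0 ≤ w - t / 2) (hℓ : 0 ≤ ℓ)
    (hℓc : ℓ ≤ (w + t / 2) * (w - t / 2))
    (hII : (w - t / 2) ^ 2 * P ≤ ℓ * ((w + t / 2) * (w - t / 2) - ℓ))
    (hr : t * w * (w - t / 2) < ℓ * (w + t / 2)) :
    ∃ v : ℝ, 0 ≤ v ∧ 2 * v ≤ w + t / 2 ∧ t * w ≤ v * (w + t / 2) ∧ v * (w - t / 2) ≤ ℓ ∧
      P ≤ v * ((w + t / 2) - v) := by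
  have hw : 0 ≤ w := by linarith
  have hX : 0 ≤ w + t / 2 := by linarith
  have hℓX : 0 < ℓ * (w + t / 2) := lt_of_le_of_lt (mul_nonneg (mul_nonneg ht hw) hY) hr
  have hℓpos : 0 < ℓ := by
    rcases eq_or_lt_of_le hℓ with h | h
    · rw [← h, zero_mul] at hℓX; exact absurd hℓX (lt_irrefl 0)
    · exact h
  have hXpos : 0 < w + t / 2 := by
    rcases eq_or_lt_of_le hX with h | h
    · rw [← h, mul_zero] at hℓX; exact absurd hℓX (lt_irrefl 0)
    · exact h
  have hYpos : 0 < w - t / 2 := by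
    rcases eq_or_lt_of_le hY with h | h
    · exfalso; rw [← h, mul_zero] at hℓc; linarith
    · exact h
  set v₀ : ℝ := ℓ / (w - t / 2) with hv₀def
  have hv₀Y : v₀ * (w - t / 2) = ℓ := by rw [hv₀def]; exact div_mul_cancel₀ ℓ hYpos.ne'
  have hv₀0 : 0 ≤ v₀ := by rw [hv₀def]; positivity
  have hPv₀ : P ≤ v₀ * ((w + t / 2) - v₀) := by
    have h1 : (w - t / 2) ^ 2 * P ≤ (w - t / 2) ^ 2 * (v₀ * ((w + t / 2) - v₀)) := by
      calc (w - t / 2) ^ 2 * P ≤ ℓ * ((w + t / 2) * (w - t / 2) - ℓ) := hII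
        _ = (w - t / 2) ^ 2 * (v₀ * ((w + t / 2) - v₀)) := by rw [← hv₀Y]; ring
    exact le_of_mul_le_mul_left h1 (by positivity)
  have htwv₀ : t * w ≤ v₀ * (w + t / 2) := by
    have h1 : (t * w) * (w - t / 2) ≤ (v₀ * (w + t / 2)) * (w - t / 2) := by
      calc (t * w) * (w - t / 2) = t * w * (w - t / 2) := by ring
        _ ≤ ℓ * (w + t / 2) := hr.le
        _ = (v₀ * (w + t / 2)) * (w - t / 2) := by rw [← hv₀Y]; ring
    exact le_of_mul_le_mul_right h1 hYpos
  by_cases h2 : 2 * v₀ ≤ w + t / 2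
  · exact ⟨v₀, hv₀0, h2, htwv₀, hv₀Y.le, hPv₀⟩
  · refine ⟨(w + t / 2) / 2, by positivity, by linarith, ?_, ?_, ?_⟩
    · nlinarith [sq_nonneg (w - t / 2)]
    · have h3 : (w + t / 2) * (w - t / 2) < 2 * v₀ * (w - t / 2) :=
        mul_lt_mul_of_pos_right (lt_of_not_ge h2) hYpos
      have h4 : 2 * v₀ * (w - t / 2) = 2 * ℓ := by rw [← hv₀Y]; ring
      nlinarith [h3, h4]
    · nlinarith [hPv₀, sq_nonneg (v₀ - (w + t / 2) / 2)]

end Summit.Ventures.LatticeQCDFlow.TrivializingMaps.Curve
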